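import Literature.MathematicalPhysics.KineticTheory.PureQuarticChainNESS
import Literature.MathematicalPhysics.KineticTheory.LangevinChainDegenerateHormander
import Literature.Analysis.Hypoelliptic.HormanderProof
import HarnessLib

/-!
# Smooth invariant densities of the purely quartic chain (CEHR Thm 2.13 (1), density clause; Props. 3.2 and 4.1)

Topic `Literature/MathematicalPhysics/KineticTheory` (trunk T-KINETIC). Proof file of the provefact
unit for `CuneoEckmannHairerReyBellet2018_thm213_pureQuartic` (`PureQuarticChainNESS.lean`).
Cuneo–Eckmann–Hairer–Rey-Bellet, EJP **23** (2018) no. 55: Proposition 4.1 (H1, Hörmander's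
bracket condition) and Proposition 3.2, last sentence ("every invariant measure has a smooth
density with respect to Lebesgue measure"), for the purely quartic chain
`pureQuarticChain μ γ = ⟨μq⁴/4, r⁴/4, γ⟩`, whose coupling is non-degenerate of order `ℓ = 3` only
(`V''(0) = 0`, `V'''' = 6`; Def. 2.4, Example 2.5: "`‖x‖^r` with `r = 2, 4, 6, …` is
non-degenerate").

The bracket condition for chains with a coupling non-degenerate of finite order at every point
(`RBNondegenerate P.V`) is PROVED in `LangevinChainDegenerateHormander.lean`
(`OscillatorChain.isBracketGenerating_hormanderFamily_of_rbNondegenerate`, the germ-module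
argument of the printed proof, p. 10), together with the smooth density of weakly stationary
finite measures GIVEN Hörmander's Theorem 1.1 (`…hasSmoothDensity_of_integral_generator_eq_zero hH`).
Hörmander's theorem is itself proved in the tree
(`Literature.Analysis.Hypoelliptic.hormander1967_thm11_proof`). This short file closes the loop for
the purely quartic chain (everything PROVED, no definition, no named fact):

* `rbNondegenerate_pureQuarticChain_V` — `(r⁴/4)⁽⁴⁾ = 6 ≠ 0`: the coupling is RB-non-degenerate
  (`m = 4` at every point);
* `pureQuarticChain_isBracketGenerating` — **Prop. 4.1 (H1) for the purely quartic chain**;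
* `OscillatorChain.hasSmoothDensity_of_isInvariant_of_rbNondegenerate` — for any chain with smooth
  potentials, RB-non-degenerate coupling, `γ, T_L > 0`, `T_R ≥ 0`: every finite invariant measure
  of ANY `LangevinChainSemigroup` of the chain has a smooth density (Dynkin ⟹ weak stationarity,
  `LangevinChainSemigroup.IsInvariant.integral_generator_eq_zero`; then Hörmander, unconditionally);
* `pureQuarticChain_hasSmoothDensity_of_integral_generator_eq_zero`,
  `pureQuarticChain_hasSmoothDensity_of_isInvariant` — **the smooth-density clause of
  Theorem 2.13 (1) for the purely quartic chain, PROVED unconditionally** (for every semigroup of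
  the chain, in particular the transition semigroup of the SDE (2.2)).

## References

* N. Cuneo, J.-P. Eckmann, M. Hairer, L. Rey-Bellet, EJP **23** (2018) no. 55 (arXiv:1712.09413),
  Def. 2.4, Example 2.5, Prop. 3.2, Prop. 4.1. Page numbers refer to the arXiv version.
* L. Hörmander, Acta Math. **119** (1967) 147–171, Thm 1.1.
-/

noncomputable section

open MeasureTheory Filter Topology Set
open Literature.Analysis.Distribution
open scoped ContDiff NNReal ENNReal

namespace Literature.MathematicalPhysics.KineticTheory.HeatConduction

variable {N : ℕ}

namespace OscillatorChain

variable (P : OscillatorChain)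

/-- **Every finite invariant measure of a Markov semigroup of a chain with RB-non-degenerate
coupling has a smooth density** (CEHR Prop. 3.2, "every invariant measure has a smooth density
with respect to Lebesgue measure"; smooth potentials, `γ, T_L > 0`, `T_R ≥ 0`, `N ≥ 1`): invariant
finite measures are weakly stationary by Dynkin's identity
(`LangevinChainSemigroup.IsInvariant.integral_generator_eq_zero`), weakly stationary finite
measures have smooth densities by Prop. 4.1 and Hörmander's Theorem 1.1
(`hasSmoothDensity_of_integral_generator_eq_zero`, with the theorem supplied by
`Literature.Analysis.Hypoelliptic.hormander1967_thm11_proof`).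
[cite: CuneoEckmannHairerReyBellet2018, Prop 3.2] [cite: Hormander1967, Thm 1.1] -/
theorem hasSmoothDensity_of_isInvariant_of_rbNondegenerate (hU : ContDiff ℝ ∞ P.U)
    (hV : ContDiff ℝ ∞ P.V) (hV2 : RBNondegenerate P.V) (hγ : 0 < P.γ) (hN : 0 < N) {T_L T_R : ℝ}
    (hL : 0 < T_L) (hR : 0 ≤ T_R) (S : LangevinChainSemigroup P N T_L T_R)
    (μ : Measure (PhaseSpace N)) [IsFiniteMeasure μ] (hμ : S.IsInvariant μ) : HasSmoothDensity μ := by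
  refine P.hasSmoothDensity_of_integral_generator_eq_zero
    Literature.Analysis.Hypoelliptic.hormander1967_thm11_proof hU hV hV2 hγ hN hL hR μ
    fun f hf hfc => ?_
  have hf2 : ContDiff ℝ 2 f := hf.of_le (by norm_cast)
  have hU1 : ContDiff ℝ 1 P.U := hU.of_le (by norm_cast)
  have hV1 : ContDiff ℝ 1 P.V := hV.of_le (by norm_cast)
  exact hμ.integral_generator_eq_zero S hf hfc (P.continuous_generator hU1 hV1 N T_L T_R hf2).stronglyMeasurable
    (P.exists_bound_generator hU1 hV1 N T_L T_R hf2 hfc)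

end OscillatorChain

/-! ### The purely quartic coupling is non-degenerate of order three -/

/-- `V' = r³` for `V = r⁴/4`, as a function. [folklore] -/
theorem pureQuarticChain_deriv_V_eq (μ γ : ℝ) : deriv (pureQuarticChain μ γ).V = fun r => r ^ 3 :=
  funext (pureQuarticChain_deriv_V μ γ)

/-- `V'''' = 6` for `V = r⁴/4`: the purely quartic coupling is non-degenerate of order `3`
(CEHR Def. 2.4 / Example 2.5: "`‖x‖^r` with `r = 2, 4, 6, …` is non-degenerate").
[cite: CuneoEckmannHairerReyBellet2018, Example 2.5] -/
theorem pureQuarticChain_iteratedDeriv_four_V (μ γ r : ℝ) :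
    iteratedDeriv 4 (pureQuarticChain μ γ).V r = 6 := by
  have h1 : iteratedDeriv 1 (pureQuarticChain μ γ).V = fun r => r ^ 3 := by
    rw [iteratedDeriv_one]; exact pureQuarticChain_deriv_V_eq μ γ
  have h2 : iteratedDeriv 2 (pureQuarticChain μ γ).V = fun r => 3 * r ^ 2 := by
    rw [iteratedDeriv_succ, h1]
    funext r
    have h : HasDerivAt (fun r : ℝ => r ^ 3) (↑(3 : ℕ) * r ^ (3 - 1)) r := hasDerivAt_pow 3 r
    rw [h.deriv]; norm_num
  have h3 : iteratedDeriv 3 (pureQuarticChain μ γ).V = fun r => 6 * r := by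
    rw [iteratedDeriv_succ, h2]
    funext r
    have h : HasDerivAt (fun r : ℝ => 3 * r ^ 2) (3 * (↑(2 : ℕ) * r ^ (2 - 1))) r :=
      (hasDerivAt_pow 2 r).const_mul 3
    rw [h.deriv]; norm_num; ring
  rw [iteratedDeriv_succ, h3]
  have h : HasDerivAt (fun r : ℝ => 6 * r) (6 * 1) r := (hasDerivAt_id r).const_mul 6
  rw [h.deriv]; norm_num

/-- The purely quartic coupling is non-degenerate of finite order at every point (`m = 4`).
[cite: CuneoEckmannHairerReyBellet2018, Example 2.5] -/
theorem rbNondegenerate_pureQuarticChain_V (μ γ : ℝ) : RBNondegenerate (pureQuarticChain μ γ).V :=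
  fun r => ⟨4, by norm_num, by rw [pureQuarticChain_iteratedDeriv_four_V]; norm_num⟩

/-- **CEHR Proposition 4.1 (H1) for the purely quartic chain, PROVED** (`γ, T_L > 0`, `N ≥ 1`,
any `μ`, `T_R`): Hörmander's bracket condition for `L* = X_L² + X_R² - Y + 2γ` on all of phase
space, although `V''(0) = 0` (brackets of length up to four in `∂_{q}` are used where a bond is
unstretched). [cite: CuneoEckmannHairerReyBellet2018, Prop 4.1] -/
theorem pureQuarticChain_isBracketGenerating (μ : ℝ) {γ : ℝ} (hγ : 0 < γ) (hN : 0 < N)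
    {T_L : ℝ} (hTL : 0 < T_L) (T_R : ℝ) :
    IsBracketGenerating ((pureQuarticChain μ γ).hormanderFamily hN T_L T_R) univ :=
  (pureQuarticChain μ γ).isBracketGenerating_hormanderFamily_of_rbNondegenerate hN
    (pureQuarticChain_contDiff_U μ γ) (pureQuarticChain_contDiff_V μ γ)
    (rbNondegenerate_pureQuarticChain_V μ γ) (mul_pos hγ hTL)

/-- **Weak steady states of the purely quartic chain have smooth densities** (`γ, T_L > 0`,
`T_R ≥ 0`, `N ≥ 1`): a finite measure with `∫ Lf dμ = 0` for all `f ∈ C_c^∞` has a smooth Lebesgue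
density — unconditionally (Hörmander's theorem is proved in the tree).
[cite: CuneoEckmannHairerReyBellet2018, Prop 3.2] [cite: Hormander1967, Thm 1.1] -/
theorem pureQuarticChain_hasSmoothDensity_of_integral_generator_eq_zero (μ : ℝ) {γ : ℝ} (hγ : 0 < γ)
    (hN : 0 < N) {T_L T_R : ℝ} (hTL : 0 < T_L) (hTR : 0 ≤ T_R) (m : Measure (PhaseSpace N))
    [IsFiniteMeasure m]
    (hstat : ∀ f : PhaseSpace N → ℝ, ContDiff ℝ ∞ f → HasCompactSupport f →
      ∫ x, (pureQuarticChain μ γ).generator N T_L T_R f x ∂m = 0) :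
    HasSmoothDensity m :=
  (pureQuarticChain μ γ).hasSmoothDensity_of_integral_generator_eq_zero
    Literature.Analysis.Hypoelliptic.hormander1967_thm11_proof
    (pureQuarticChain_contDiff_U μ γ) (pureQuarticChain_contDiff_V μ γ)
    (rbNondegenerate_pureQuarticChain_V μ γ) (by exact hγ) hN hTL hTR m hstat

/-- **Theorem 2.13 (1), smooth-density clause, for the purely quartic chain, PROVED
unconditionally**: every finite invariant measure of ANY Markov semigroup of the purely quartic
chain (interface `LangevinChainSemigroup`; in particular the transition semigroup of the SDE (2.2))
has a smooth density with respect to Lebesgue measure (`γ, T_L > 0`, `T_R ≥ 0`, `N ≥ 1`).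
[cite: CuneoEckmannHairerReyBellet2018, Thm 2.13 (1) and Prop 3.2] -/
theorem pureQuarticChain_hasSmoothDensity_of_isInvariant (μ : ℝ) {γ : ℝ} (hγ : 0 < γ) (hN : 0 < N)
    {T_L T_R : ℝ} (hTL : 0 < T_L) (hTR : 0 ≤ T_R)
    (S : LangevinChainSemigroup (pureQuarticChain μ γ) N T_L T_R) (m : Measure (PhaseSpace N))
    [IsFiniteMeasure m] (hm : S.IsInvariant m) : HasSmoothDensity m :=
  (pureQuarticChain μ γ).hasSmoothDensity_of_isInvariant_of_rbNondegenerate (pureQuarticChain_contDiff_U μ γ)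
    (pureQuarticChain_contDiff_V μ γ) (rbNondegenerate_pureQuarticChain_V μ γ) (by exact hγ) hN hTL hTR
    S m hm

end Literature.MathematicalPhysics.KineticTheory.HeatConduction

end
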